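import Summits.QuantumFields.YangMills.Theorems.BalabanUVNodesN15KingModelPerturbedMixed

/-!
# Route «BalabanUVNodes» (K4 «SpineRates»), node N15 = NE2 — THE KING-MODEL RUNG, part 7c: THE CONTINUUM-LIMIT DRESSED COVARIANCE IS DIFFERENTIABLE IN THE
# BACKGROUND COUPLING; THE BACKGROUND-DERIVATIVE AND THE η → 0 LIMIT COMMUTE, AT RATE `L^{−k}` (position-space currency, decay kept)

Cell `pub-ymgap`, Track A (D-0062), seat `pub-ymgap-dag-n15-d` (R134 seat, strategy s3 «King 1986 Lemma 4.5 (4.38) as the scalar kernel», gen 5;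
dag-lead FAN-OUT v1.2 §N15 s3 «KING-MODEL RUNG»).  `bears_on: R4∕N15`; `--supports` the K3′ item `SpineGivenEndpointR12` (stmt-QuantumFields-19908,
rev 15).  COUNT-NEUTRAL; THEOREMS ONLY (0 `def`, 0 `sorry`, standard axioms).

WHY THIS FILE.  Parts 7a∕7b gave the η-rate of the FIRST-ORDER background term and of the background-dependent part of King's dressed covariance,
linear in the background size.  The Spine's resolvent route states the corresponding operator-norm facts as «rate uniform in the coupling `t`» ∧
«`t ↦ c_∞(t)` holomorphic on the Neumann disc» (`Support.PerturbedLimitAnalytic.differentiableOn_pertLim`).  THIS FILE is the position-space differentiability twin (real coupling, every point of the window),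
BY NAME on King's tower: along any perturbation DIRECTION `P` (a tower local at King's Combes–Thomas rate `κ′` with size `c_P` and two-spacing rate
`ε_P·L^{−2j}`, entrywise limit `P_∞`) and for couplings `t` in the window `|t|·c_P, |t|·ε_P ≤ c̄`:
 * §1 generic — `kernelDecay_smul`∕`supRate_smul` (the tower `t•P` carries both letters at sizes `|t|c_P`, `|t|ε_P`) and **`hasDerivAt_inv_affine_apply`**:
   for real matrices `A, P` with `A + (t ± δ)•P` coercive, `u ↦ (A + u•P)⁻¹(x,y)` has derivative `−((A + tP)⁻¹P(A + tP)⁻¹)(x,y)` at `t` — King's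
   interpolation `King1986.hasDerivAt_covOp_apply` ((4.39), kernel) on the segment between the two endpoints, affinely reparametrised;
 * §2 King by name — `kingCovLimE_smul_eq` (part 6c's `D_{tP}^{(∞)}` IS `Δ^{(∞)} + t•P_∞`: `C^{(∞)}_{tP} = (Δ^{(∞)} + t•P_∞ + aL⁻²Q*Q)⁻¹`, coercive with
   `γ₀ − |t|c_PV`); **`hasDerivAt_kingCovE_smul`** (level `j`: `∂_tC^{(j)}_{tP}(x,y) = −(C^{(j)}_{tP}P_jC^{(j)}_{tP})(x,y)`) and **`hasDerivAt_kingCovLimE_smul`**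
   (level `∞`: `∂_tC^{(∞)}_{tP}(x,y) = −(C^{(∞)}_{tP}P_∞C^{(∞)}_{tP})(x,y)`, on the open window `|t| < T`, `T·c_P, T·ε_P ≤ c̄`);
 * §3 the rate — **`kingFirstOrderE_rate`** (7a's `firstOrder_rate_of_leaves` on the DRESSED leaves of part 6b: the level derivatives have the η-rate
   `(c_P + √(2ε_Pc_P))·2K_mix·L^{−j}·e^{−δ₄₅|x−y|_T}`), `kingFirstOrderE_tendsto` (they converge to the level-`∞` derivative), `kingFirstOrderE_limit_rate`, and
   **`deriv_kingCovE_sub_deriv_kingCovLimE_le`**: `|∂_tC^{(j)}_{tP}(x,y) − ∂_tC^{(∞)}_{tP}(x,y)| ≤ (c_P + √(2ε_Pc_P))·2K_mix·e^{−δ₄₅|x−y|_T}·L^{−j}∕(1 − L⁻¹)` — THE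
   BACKGROUND-DERIVATIVES OF KING'S UNIT-LATTICE COVARIANCES CONVERGE AS η → 0, TO THE DERIVATIVE OF THE CONTINUUM LIMIT, AT RATE `L^{−j}`, linearly in
   the direction's size, with decay.

HONEST FRAMING ∕ LIMITS.  As parts 6a–7b: King's `A = 0` SCALAR tower (periodic b.c., flat blocks, `m² > 0`, `L ≥ 2`, levels `k ≥ 1`) DRESSED BY AN
ABSTRACT LOCAL PERTURBATION TOWER along a real coupling; the letters are a READING of [B9]'s (3.35)∕(3.36) slots as locality ∕ two-spacing bounds — for
Bałaban's `Δ^{(k)}(U) − Δ^{(k)}(1)` NOT PRINTED (the Spine's (H-bd)∕(H-cons) in position space), asserted by nobody; King prints (4.38)–(4.41) at `A = 0`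
only (p. 670) and no statement about background derivatives; [B9] Thm 3.4 p. 400 prints ANALYTICITY in the background at FIXED spacing (the shape whose
η → 0 behaviour is typed here), not an η-rate; NOT Bałaban's `C^{(k)}(Λ; U)`; NOT a node discharge; typed 28∕28, discharged count untouched; one finite torus
programme at fixed ε — NOT ℝ⁴ ∕ infinite volume ∕ OS ∕ mass gap ∕ Clay.  Locators only: [King1986] CMP **102** (1986) (4.33)–(4.34), (4.38) p. 674,
(4.39)–(4.41) p. 675, p. 670; [B9] = [Balaban1985BackgroundPropagators] CMP **99** (1985) (3.35)–(3.36) p. 396, Thm 3.4 p. 400, Thm 3.15 (3.187) p. 432.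
-/

noncomputable section

open scoped BigOperators Matrix
open Finset Filter Topology

namespace Summit.QuantumFields.YangMills.BalabanUVNodes.N15.KingModel

open Literature.MathematicalPhysics.QuantumFieldTheory.Balaban1983to89
open Literature.MathematicalPhysics.QuantumFieldTheory.Balaban1983to89.QGQInverse (Coercive)
open Literature.MathematicalPhysics.QuantumFieldTheory.Balaban1983to89.B5Prop11Plancherel (Tor fine)
open Literature.MathematicalPhysics.QuantumFieldTheory.King1986 (covOp interpOp dcovOp hasDerivAt_covOp_apply)
open Literature.MathematicalPhysics.QuantumFieldTheory.King1986.Torus (tdistT tdistT_isPseudoDist aminL aminL_pos CDelU CDelU_pos gam0L gam0L_pos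
  kapCT kapCT_pos_le V45 thetaBar delta45 delta45_pos)
open Summit.QuantumFields.BalabanUV.T4Continuum.NE2KingTransplant (IsPseudoMetric UniformCoercive UniformCTBound UniformKernelDecay
  EffectiveOperatorSupRate VolumeSum CovarianceTowerRate)

/-! ## §1 Generic: the scaled tower's letters; the derivative of `u ↦ (A + u•P)⁻¹` entrywise -/

section Generic

variable {n : Type*} [Fintype n] [DecidableEq n] {d : n → n → ℝ}

omit [Fintype n] [DecidableEq n] in
/-- The scaled tower `t•E` is local at size `|t|·c_E` when `E` is local at size `c_E`. [folklore] -/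
theorem kernelDecay_smul {E : ℕ → Matrix n n ℝ} {κ c : ℝ} (t : ℝ) (hE : UniformKernelDecay E d c κ) :
    UniformKernelDecay (t • E) d (|t| * c) κ := fun k z w => by
  rw [Pi.smul_apply, Matrix.smul_apply, smul_eq_mul, abs_mul, mul_assoc]
  exact mul_le_mul_of_nonneg_left (hE k z w) (abs_nonneg t)

omit [Fintype n] [DecidableEq n] in
/-- The scaled tower `t•E` has the two-spacing rate `|t|·ε_E` when `E` has the rate `ε_E`. [folklore] -/
theorem supRate_smul {E : ℕ → Matrix n n ℝ} {ε r : ℝ} (t : ℝ) (hE : EffectiveOperatorSupRate E ε r) :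
    EffectiveOperatorSupRate (t • E) (|t| * ε) r := fun k z w => by
  rw [Pi.smul_apply, Pi.smul_apply, ← smul_sub, Matrix.smul_apply, smul_eq_mul, abs_mul, mul_assoc]
  exact mul_le_mul_of_nonneg_left (hE k z w) (abs_nonneg t)

/-- **THE DERIVATIVE OF `u ↦ (A + u•P)⁻¹(x,y)`** (real matrices): if `A + (t + δ)•P` and `A + (t − δ)•P` are coercive with a common `γ > 0` (`δ > 0`), then
`HasDerivAt (u ↦ (A + u•P)⁻¹(x,y)) (−((A + t•P)⁻¹·P·(A + t•P)⁻¹)(x,y)) t` — King's interpolation formula (4.39) on the segment from `A + (t − δ)•P` to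
`A + (t + δ)•P` (`King1986.hasDerivAt_covOp_apply`, block term `0`), composed with the affine map `u ↦ (u − t + δ)∕(2δ)`. [cite: King1986, (4.39)–(4.40) pp.674–675] -/
theorem hasDerivAt_inv_affine_apply {A P : Matrix n n ℝ} {γ t δ : ℝ} (hγ : 0 < γ) (hδ : 0 < δ)
    (hp : Coercive (A + (t + δ) • P) γ) (hm : Coercive (A + (t - δ) • P) γ) (x y : n) :
    HasDerivAt (fun u : ℝ => (A + u • P)⁻¹ x y) (-(((A + t • P)⁻¹ * P * (A + t • P)⁻¹) x y)) t := by
  have hδ0 : (2 * δ) ≠ 0 := by positivity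
  have h1 : Coercive (A + (t + δ) • P + 0) γ := by rwa [add_zero]
  have h0 : Coercive (A + (t - δ) • P + 0) γ := by rwa [add_zero]
  -- the interpolation identity: `s•Δ₁ + (1 − s)•Δ₀ = A + u•P` at `s = (u − t + δ)∕(2δ)`
  have hcov : ∀ u : ℝ, covOp (A + (t + δ) • P) (A + (t - δ) • P) 0 ((u - (t - δ)) / (2 * δ)) = (A + u • P)⁻¹ := by
    intro u
    unfold covOp interpOp
    congr 1
    ext i j
    simp only [Matrix.add_apply, Matrix.smul_apply, smul_eq_mul, Matrix.zero_apply]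
    field_simp
    ring
  have hφ : HasDerivAt (fun u : ℝ => (u - (t - δ)) / (2 * δ)) (1 / (2 * δ)) t :=
    ((hasDerivAt_id' t).sub_const (t - δ)).div_const (2 * δ)
  have hs : (t - (t - δ)) / (2 * δ) ∈ Set.Ioo (0 : ℝ) 1 := by
    rw [show (t - (t - δ)) / (2 * δ) = 1 / 2 by field_simp; ring]
    constructor <;> norm_num
  have hder := hasDerivAt_covOp_apply (A + (t + δ) • P) (A + (t - δ) • P) 0 hγ h1 h0 hs x y
  have hcomp := hder.comp t hφ
  have hfun : ((fun s : ℝ => covOp (A + (t + δ) • P) (A + (t - δ) • P) 0 s x y) ∘ fun u : ℝ => (u - (t - δ)) / (2 * δ))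
      = fun u : ℝ => (A + u • P)⁻¹ x y := by
    funext u
    simp only [Function.comp_apply]
    rw [hcov u]
  have hval : dcovOp (A + (t + δ) • P) (A + (t - δ) • P) 0 ((t - (t - δ)) / (2 * δ)) x y * (1 / (2 * δ))
      = -(((A + t • P)⁻¹ * P * (A + t • P)⁻¹) x y) := by
    unfold dcovOp
    rw [hcov t]
    have e : A + (t - δ) • P - (A + (t + δ) • P) = (-(2 * δ)) • P := by
      ext i j
      simp only [Matrix.sub_apply, Matrix.add_apply, Matrix.smul_apply, smul_eq_mul]
      ring
    rw [e, Matrix.mul_smul, Matrix.smul_mul, Matrix.smul_apply, smul_eq_mul]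
    field_simp
  rw [hfun, hval] at hcomp
  exact hcomp

end Generic

/-! ## §2 King by name: the dressed limit along a direction, and the background-derivatives at every level and at the limit -/

section King

variable {dd : ℕ} {a m2 : ℝ} {L : ℕ} [NeZero L] {M : Fin dd → ℕ} [∀ μ, NeZero (M μ)]

/-- **THE DRESSED CONTINUUM LIMIT ALONG A DIRECTION** (`L ≥ 2`, `a, m² > 0`): for a direction `P` (local at `κ′` with size `c_P`, two-spacing rate `ε_P·L^{−2j}`,
entrywise limit `P_∞`) and a coupling with `|t|·c_P, |t|·ε_P ≤ c̄`, part 6c's dressed limit at `E = t•P` is `C^{(∞)}_{tP} = (Δ^{(∞)} + t•P_∞ + aL⁻²Q*Q)⁻¹`,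
the operator `Δ^{(∞)} + t•P_∞ + aL⁻²Q*Q` is coercive with `γ₀ − |t|c_PV`, and `C^{(j)}_{tP} → C^{(∞)}_{tP}` entrywise. [cite: King1986, (4.33) p.674, §4 pp.675–676 (A = 0 template)] -/
theorem kingCovLimE_smul_eq (ha : 0 < a) (hm : 0 < m2) (hL : 2 ≤ L) {P : ℕ → Matrix (Tor (fine L M)) (Tor (fine L M)) ℝ}
    {Pinf : Matrix (Tor (fine L M)) (Tor (fine L M)) ℝ} {cP εP t : ℝ} (hcP0 : 0 ≤ cP) (hεP0 : 0 ≤ εP) (htc : |t| * cP ≤ kingCbar dd a L)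
    (htε : |t| * εP ≤ kingCbar dd a L) (h335 : UniformKernelDecay P (tdistT (fine L M)) cP (kapCT dd a L))
    (h336 : EffectiveOperatorSupRate P εP (((L : ℝ) ^ 2)⁻¹)) (hP : ∀ z w, Tendsto (fun k => P k z w) atTop (𝓝 (Pinf z w))) :
    kingCovLimE a m2 L M (t • P) = (kingLevelLim a m2 L M + t • Pinf + kingBlock a L M)⁻¹ ∧
      Coercive (kingLevelLim a m2 L M + t • Pinf + kingBlock a L M) (gam0L dd a L - |t| * cP * V45 dd a L) ∧
      ∀ x y, Tendsto (fun k => kingCovE a m2 L M (t • P) k x y) atTop (𝓝 (kingCovLimE a m2 L M (t • P) x y)) := by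
  obtain ⟨DinfE, hD, hCeq, -, hco, hCt, -⟩ := kingCovE_tendsto_kingCovLimE (dd := dd) ha hm hL (by positivity) htc (by positivity) htε
    (kernelDecay_smul t h335) (supRate_smul t h336)
  have hDE : DinfE = kingLevelLim a m2 L M + t • Pinf := by
    ext z w
    have h1 : Tendsto (fun k => (kingTower a m2 L M + t • P) k z w) atTop (𝓝 (kingLevelLim a m2 L M z w + t * Pinf z w)) := by
      refine (((kingTower_tendsto ha hm hL z w).1).add ((hP z w).const_mul t)).congr' (Eventually.of_forall fun k => ?_)
      simp only [Pi.add_apply, Pi.smul_apply, Matrix.add_apply, Matrix.smul_apply, smul_eq_mul]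
    rw [tendsto_nhds_unique (hD z w) h1, Matrix.add_apply, Matrix.smul_apply, smul_eq_mul]
  exact ⟨by rw [hCeq, hDE], by rw [← hDE]; exact hco, hCt⟩

/-- Coercivity of the dressed level operator `Δ^{(max j 1)} + aL⁻²Q*Q + u•P_j` for `|u| ≤ T`, `T·c_P ≤ c̄`: constant `γ₀ − T·c_PV` (6a's
`uniformCoercive_add_of_decay`; only the locality of `P` is used). [cite: King1986, (4.33) p.674] -/
theorem coercive_kingLevel_add_smul (ha : 0 < a) (hm : 0 < m2) (hL : 2 ≤ L) {P : ℕ → Matrix (Tor (fine L M)) (Tor (fine L M)) ℝ} {cP T u : ℝ}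
    (hcP0 : 0 ≤ cP) (hu : |u| ≤ T) (h335 : UniformKernelDecay P (tdistT (fine L M)) cP (kapCT dd a L)) (j : ℕ) :
    Coercive (kingTower a m2 L M j + kingBlock a L M + u • P j) (gam0L dd a L - T * cP * V45 dd a L) := by
  have h := uniformCoercive_add_of_decay (isPseudoMetric_tdistT (fine L M)) (kapCT_pos_le (d := dd) ha hL).1.le (by positivity)
    (uniformCoercive_kingTower ha hm hL) (kernelDecay_smul u h335) (volumeSum_kingTorus ha hL) j
  rw [Pi.add_apply, Pi.smul_apply, add_right_comm] at h
  refine coercive_of_le h ?_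
  have hV := (V45_pos dd ha hL).le
  nlinarith [mul_le_mul_of_nonneg_right (mul_le_mul_of_nonneg_right hu hcP0) hV]

/-- **THE BACKGROUND-DERIVATIVE AT LEVEL `j`**: for a direction `P` local at `κ′` with size `c_P` and couplings in the open window `|t| < T`, `T·c_P ≤ c̄`,
`∂_t C^{(j)}_{tP}(x,y) = −(C^{(j)}_{tP}·P_j·C^{(j)}_{tP})(x,y)` (`C^{(j)}_{tP} = kingCovE (t•P) j`). [cite: King1986, (4.39)–(4.40) pp.674–675 (the interpolation derivative)] -/
theorem hasDerivAt_kingCovE_smul (ha : 0 < a) (hm : 0 < m2) (hL : 2 ≤ L) {P : ℕ → Matrix (Tor (fine L M)) (Tor (fine L M)) ℝ} {cP T t : ℝ}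
    (hcP0 : 0 ≤ cP) (hT : T * cP ≤ kingCbar dd a L) (ht : |t| < T) (h335 : UniformKernelDecay P (tdistT (fine L M)) cP (kapCT dd a L)) (j : ℕ)
    (x y : Tor (fine L M)) :
    HasDerivAt (fun u : ℝ => kingCovE a m2 L M (u • P) j x y)
      (-((kingCovE a m2 L M (t • P) j * P j * kingCovE a m2 L M (t • P) j) x y)) t := by
  have hδ0 : 0 < (T - |t|) / 2 := by linarith
  have hγ : 0 < gam0L dd a L - T * cP * V45 dd a L := by
    have h1 := kingCbar_mul_V45 (dd := dd) ha hL
    have h2 := gam0L_pos (d := dd) ha hL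
    have h3 : T * cP * V45 dd a L ≤ kingCbar dd a L * V45 dd a L := mul_le_mul_of_nonneg_right hT (V45_pos dd ha hL).le
    linarith
  have hp : |t + (T - |t|) / 2| ≤ T := by
    refine (abs_add_le _ _).trans ?_; rw [abs_of_pos hδ0]; linarith
  have hm' : |t - (T - |t|) / 2| ≤ T := by
    refine (abs_sub _ _).trans ?_; rw [abs_of_pos hδ0]; linarith
  have hfun : (fun u : ℝ => kingCovE a m2 L M (u • P) j x y) = fun u : ℝ => (kingTower a m2 L M j + kingBlock a L M + u • P j)⁻¹ x y := by
    funext u; simp only [kingCovE, Pi.smul_apply, add_right_comm]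
  have hval : kingCovE a m2 L M (t • P) j = (kingTower a m2 L M j + kingBlock a L M + t • P j)⁻¹ := by
    simp only [kingCovE, Pi.smul_apply, add_right_comm]
  rw [hfun, hval]
  exact hasDerivAt_inv_affine_apply hγ hδ0 (coercive_kingLevel_add_smul (dd := dd) ha hm hL hcP0 hp h335 j)
    (coercive_kingLevel_add_smul (dd := dd) ha hm hL hcP0 hm' h335 j) x y

/-- **THE CONTINUUM-LIMIT DRESSED COVARIANCE IS DIFFERENTIABLE IN THE COUPLING**: for a direction `P` (local at `κ′`, size `c_P`; two-spacing rate `ε_P·L^{−2j}`;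
entrywise limit `P_∞`) and the open window `|t| < T` with `T·c_P ≤ c̄`, `T·ε_P ≤ c̄`:
`HasDerivAt (u ↦ C^{(∞)}_{uP}(x,y)) (−(C^{(∞)}_{tP}·P_∞·C^{(∞)}_{tP})(x,y)) t` — the position-space (real-differentiability) twin of the Spine's holomorphy station
(`PerturbedLimitAnalytic.differentiableOn_pertLim`). [cite: King1986, (4.39)–(4.40) pp.674–675 (the interpolation derivative), §4 pp.675–676; Balaban1985BackgroundPropagators, Thm 3.4 p.400 (analytic dependence on the background at fixed spacing: the shape)] -/
theorem hasDerivAt_kingCovLimE_smul (ha : 0 < a) (hm : 0 < m2) (hL : 2 ≤ L) {P : ℕ → Matrix (Tor (fine L M)) (Tor (fine L M)) ℝ}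
    {Pinf : Matrix (Tor (fine L M)) (Tor (fine L M)) ℝ} {cP εP T t : ℝ} (hcP0 : 0 ≤ cP) (hεP0 : 0 ≤ εP) (hT : T * cP ≤ kingCbar dd a L)
    (hT' : T * εP ≤ kingCbar dd a L) (ht : |t| < T) (h335 : UniformKernelDecay P (tdistT (fine L M)) cP (kapCT dd a L))
    (h336 : EffectiveOperatorSupRate P εP (((L : ℝ) ^ 2)⁻¹)) (hP : ∀ z w, Tendsto (fun k => P k z w) atTop (𝓝 (Pinf z w))) (x y : Tor (fine L M)) :
    HasDerivAt (fun u : ℝ => kingCovLimE a m2 L M (u • P) x y)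
      (-((kingCovLimE a m2 L M (t • P) * Pinf * kingCovLimE a m2 L M (t • P)) x y)) t := by
  have hδ0 : 0 < (T - |t|) / 2 := by linarith
  have hV := (V45_pos dd ha hL).le
  have hγ : 0 < gam0L dd a L - T * cP * V45 dd a L := by
    have h1 := kingCbar_mul_V45 (dd := dd) ha hL
    have h2 := gam0L_pos (d := dd) ha hL
    have h3 : T * cP * V45 dd a L ≤ kingCbar dd a L * V45 dd a L := mul_le_mul_of_nonneg_right hT hV
    linarith
  -- the identification and coercivity at every coupling `|u| ≤ T`
  have key : ∀ u : ℝ, |u| ≤ T → kingCovLimE a m2 L M (u • P) = (kingLevelLim a m2 L M + kingBlock a L M + u • Pinf)⁻¹ ∧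
      Coercive (kingLevelLim a m2 L M + kingBlock a L M + u • Pinf) (gam0L dd a L - T * cP * V45 dd a L) := by
    intro u hu
    have huc : |u| * cP ≤ kingCbar dd a L := (mul_le_mul_of_nonneg_right hu hcP0).trans hT
    have huε : |u| * εP ≤ kingCbar dd a L := (mul_le_mul_of_nonneg_right hu hεP0).trans hT'
    obtain ⟨h1, h2, -⟩ := kingCovLimE_smul_eq (dd := dd) ha hm hL hcP0 hεP0 huc huε h335 h336 hP
    rw [add_right_comm] at h1 h2
    exact ⟨h1, coercive_of_le h2 (by nlinarith [mul_le_mul_of_nonneg_right (mul_le_mul_of_nonneg_right hu hcP0) hV])⟩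
  have hp : |t + (T - |t|) / 2| ≤ T := by
    refine (abs_add_le _ _).trans ?_; rw [abs_of_pos hδ0]; linarith
  have hm' : |t - (T - |t|) / 2| ≤ T := by
    refine (abs_sub _ _).trans ?_; rw [abs_of_pos hδ0]; linarith
  have hder := hasDerivAt_inv_affine_apply hγ hδ0 (key _ hp).2 (key _ hm').2 x y
  rw [← (key t ht.le).1] at hder
  refine hder.congr_of_eventuallyEq ?_
  have hnhds : Set.Ioo (-T) T ∈ 𝓝 t := Ioo_mem_nhds (by linarith [neg_abs_le t]) (lt_of_le_of_lt (le_abs_self t) ht)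
  filter_upwards [hnhds] with u hu
  rw [(key u (abs_le.mpr ⟨hu.1.le, hu.2.le⟩)).1]

end King

/-! ## §3 The rate: the level derivatives converge to the limit derivative at rate `L^{−j}`, linearly in the direction's size -/

section Rate

variable {dd : ℕ} {a m2 : ℝ} {L : ℕ} [NeZero L] {M : Fin dd → ℕ} [∀ μ, NeZero (M μ)]

omit [NeZero L] [∀ μ, NeZero (M μ)] in
/-- Domination of the DRESSED sandwich constant: with `C′ ≤ C_K^E`, `A′ ≤ 4∕γ₀`, `(C′c_PA′ + A′√(2ε_Pc_P)A′ + A′c_PC′)·V² ≤ (c_P + √(2ε_Pc_P))·2K_mix`. [folklore] -/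
theorem sandwichConstE_le_kingKmix (ha : 0 < a) (hL : 2 ≤ L) {C' A' cP εP : ℝ} (hC'0 : 0 ≤ C') (hC' : C' ≤ kingCE dd a L) (hA'0 : 0 ≤ A')
    (hA' : A' ≤ 4 / gam0L dd a L) (hcP : 0 ≤ cP) :
    (C' * cP * A' + A' * Real.sqrt (2 * (εP * cP)) * A' + A' * cP * C') * V45 dd a L ^ 2
      ≤ (cP + Real.sqrt (2 * (εP * cP))) * (2 * kingKmix dd a L) := by
  have hC := kingC_nonneg dd a L
  have hCE := (kingCE_pos (dd := dd) ha hL).2.le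
  have hs := Real.sqrt_nonneg (2 * (εP * cP))
  have hV2 : 0 ≤ V45 dd a L ^ 2 := sq_nonneg _
  have hg : 0 ≤ 4 / gam0L dd a L := by have := gam0L_pos (d := dd) ha hL; positivity
  have h1 : C' * cP * A' ≤ kingCE dd a L * cP * (4 / gam0L dd a L) :=
    mul_le_mul (mul_le_mul_of_nonneg_right hC' hcP) hA' hA'0 (mul_nonneg hCE hcP)
  have h2 : A' * Real.sqrt (2 * (εP * cP)) * A' ≤ 4 / gam0L dd a L * Real.sqrt (2 * (εP * cP)) * (4 / gam0L dd a L) :=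
    mul_le_mul (mul_le_mul_of_nonneg_right hA' hs) hA' hA'0 (mul_nonneg hg hs)
  have h3 : A' * cP * C' ≤ 4 / gam0L dd a L * cP * kingCE dd a L :=
    mul_le_mul (mul_le_mul_of_nonneg_right hA' hcP) hC' hC'0 (mul_nonneg hg hcP)
  calc (C' * cP * A' + A' * Real.sqrt (2 * (εP * cP)) * A' + A' * cP * C') * V45 dd a L ^ 2
      ≤ (kingCE dd a L * cP * (4 / gam0L dd a L) + 4 / gam0L dd a L * Real.sqrt (2 * (εP * cP)) * (4 / gam0L dd a L)
          + 4 / gam0L dd a L * cP * kingCE dd a L) * V45 dd a L ^ 2 := mul_le_mul_of_nonneg_right (add_le_add (add_le_add h1 h2) h3) hV2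
    _ = (cP + Real.sqrt (2 * (εP * cP))) * (2 * kingKmix dd a L)
          - (2 * cP * kingC dd a L * (4 / gam0L dd a L) + 2 * cP * (4 / gam0L dd a L) ^ 2
              + 2 * Real.sqrt (2 * (εP * cP)) * ((kingCE dd a L + kingC dd a L) * (4 / gam0L dd a L))
              + Real.sqrt (2 * (εP * cP)) * (4 / gam0L dd a L) ^ 2) * V45 dd a L ^ 2 := by unfold kingKmix; ring
    _ ≤ (cP + Real.sqrt (2 * (εP * cP))) * (2 * kingKmix dd a L) := sub_le_self _ (by
        refine mul_nonneg (add_nonneg (add_nonneg (add_nonneg ?_ ?_) ?_) ?_) hV2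
        · exact mul_nonneg (mul_nonneg (mul_nonneg zero_le_two hcP) hC) hg
        · exact mul_nonneg (mul_nonneg zero_le_two hcP) (sq_nonneg _)
        · exact mul_nonneg (mul_nonneg zero_le_two hs) (mul_nonneg (add_nonneg hCE hC) hg)
        · exact mul_nonneg hs (sq_nonneg _))

/-- **THE η-RATE OF THE LEVEL DERIVATIVES** (the first-order term of the DRESSED tower): for a direction `P` (local at `κ′`, size `c_P`; two-spacing rate
`ε_P·L^{−2j}`) and a coupling with `|t|·c_P, |t|·ε_P ≤ c̄`, the terms `F_j(t) = C^{(j)}_{tP}·P_j·C^{(j)}_{tP}` obey at every level and all sites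
`|F_{j+1}(t)(x,y) − F_j(t)(x,y)| ≤ (c_P + √(2ε_Pc_P))·2K_mix·(L⁻¹)^j·e^{−δ₄₅|x−y|_T}` (7a's `firstOrder_rate_of_leaves` on part 6b's dressed leaves `kingLeavesE`).
[cite: King1986, Lemma 4.5 (4.38) p.674, (4.39)–(4.41) p.675 (the mechanism, A = 0)] -/
theorem kingFirstOrderE_rate (ha : 0 < a) (hm : 0 < m2) (hL : 2 ≤ L) {P : ℕ → Matrix (Tor (fine L M)) (Tor (fine L M)) ℝ} {cP εP t : ℝ}
    (hcP0 : 0 ≤ cP) (hεP0 : 0 ≤ εP) (htc : |t| * cP ≤ kingCbar dd a L) (htε : |t| * εP ≤ kingCbar dd a L)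
    (h335 : UniformKernelDecay P (tdistT (fine L M)) cP (kapCT dd a L)) (h336 : EffectiveOperatorSupRate P εP (((L : ℝ) ^ 2)⁻¹)) (j : ℕ)
    (x y : Tor (fine L M)) :
    |(kingCovE a m2 L M (t • P) (j + 1) * P (j + 1) * kingCovE a m2 L M (t • P) (j + 1)
        - kingCovE a m2 L M (t • P) j * P j * kingCovE a m2 L M (t • P) j) x y|
      ≤ (cP + Real.sqrt (2 * (εP * cP))) * (2 * kingKmix dd a L) * ((L : ℝ)⁻¹) ^ j * Real.exp (-(delta45 dd a L * tdistT (fine L M) x y)) := by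
  have htc0 : 0 ≤ |t| * cP := by positivity
  have htε0 : 0 ≤ |t| * εP := by positivity
  have hθ := thetaBar_mul_nonneg (a := a) ha hL
  obtain ⟨g1, g2, g2', g3, g4⟩ := kingLeavesE (dd := dd) ha hm hL htc0 (kernelDecay_smul t h335) (supRate_smul t h336)
  have hgap : (kingRho dd a L + |t| * cP * V45 dd a L) + kingRhoB dd a L < gam0L dd a L - |t| * cP * V45 dd a L := by
    have := kingGap (dd := dd) ha hL htc; linarith
  have h := firstOrder_rate_of_leaves (isPseudoMetric_tdistT (fine L M)) hgap (kapCT_pos_le (d := dd) ha hL).1.le (add_nonneg hθ htε0) (by positivity)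
    hcP0 hεP0 g1 g2 g2' g3 g4 h335 h336 j x y
  simp only [Pi.add_apply] at h
  rw [sqrt_inv_sq_L] at h
  refine le_trans (le_of_eq (by rfl)) (h.trans ?_)
  show _ ≤ _ * Real.exp (-(kapCT dd a L / 2 * tdistT (fine L M) x y))
  have hA'0 : 0 ≤ ((gam0L dd a L - |t| * cP * V45 dd a L) - ((kingRho dd a L + |t| * cP * V45 dd a L) + kingRhoB dd a L))⁻¹ :=
    inv_nonneg.mpr (sub_nonneg.mpr hgap.le)
  have hA' := inv_dressedMargin_le (dd := dd) ha hL htc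
  have hconst : Real.sqrt ((thetaBar a L * a + |t| * εP) * (2 * (CDelU dd a (aminL a L) + |t| * cP)))
      * (((gam0L dd a L - |t| * cP * V45 dd a L) - ((kingRho dd a L + |t| * cP * V45 dd a L) + kingRhoB dd a L))⁻¹) ^ 2 * V45 dd a L ^ 2
        ≤ kingCE dd a L := by
    have hC := CDelU_pos (d := dd) ha (aminL_pos ha hL)
    have hcb := (kingCbar_pos (dd := dd) ha hL).le
    unfold kingCE
    rw [mul_assoc]
    exact mul_le_mul (Real.sqrt_le_sqrt (by gcongr)) (inv_margin_sq_le (dd := dd) ha hL htc) (by positivity) (Real.sqrt_nonneg _)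
  have hdom := sandwichConstE_le_kingKmix (dd := dd) (εP := εP) ha hL (by positivity) hconst hA'0 hA' hcP0
  exact mul_le_mul_of_nonneg_right (mul_le_mul_of_nonneg_right hdom (pow_nonneg (inv_nonneg.mpr (Nat.cast_nonneg L)) j)) (Real.exp_pos _).le

/-- **THE LEVEL DERIVATIVES CONVERGE TO THE LIMIT DERIVATIVE**: `F_j(t)(x,y) → F_∞(t)(x,y) = (C^{(∞)}_{tP}·P_∞·C^{(∞)}_{tP})(x,y)` (entrywise limits pass
through the two products). [cite: King1986, §4 pp.675–676 (passage to the limit, A = 0 template)] -/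
theorem kingFirstOrderE_tendsto (ha : 0 < a) (hm : 0 < m2) (hL : 2 ≤ L) {P : ℕ → Matrix (Tor (fine L M)) (Tor (fine L M)) ℝ}
    {Pinf : Matrix (Tor (fine L M)) (Tor (fine L M)) ℝ} {cP εP t : ℝ} (hcP0 : 0 ≤ cP) (hεP0 : 0 ≤ εP) (htc : |t| * cP ≤ kingCbar dd a L)
    (htε : |t| * εP ≤ kingCbar dd a L) (h335 : UniformKernelDecay P (tdistT (fine L M)) cP (kapCT dd a L))
    (h336 : EffectiveOperatorSupRate P εP (((L : ℝ) ^ 2)⁻¹)) (hP : ∀ z w, Tendsto (fun k => P k z w) atTop (𝓝 (Pinf z w))) (x y : Tor (fine L M)) :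
    Tendsto (fun k => (kingCovE a m2 L M (t • P) k * P k * kingCovE a m2 L M (t • P) k) x y) atTop
      (𝓝 ((kingCovLimE a m2 L M (t • P) * Pinf * kingCovLimE a m2 L M (t • P)) x y)) := by
  obtain ⟨-, -, hC⟩ := kingCovLimE_smul_eq (dd := dd) ha hm hL hcP0 hεP0 htc htε h335 h336 hP
  exact tendsto_matrix_mul_apply (A := fun k => kingCovE a m2 L M (t • P) k * P k) (fun z w => tendsto_matrix_mul_apply hC hP z w) hC x y

/-- **… AT RATE `L^{−j}`**: `|F_j(t)(x,y) − F_∞(t)(x,y)| ≤ (c_P + √(2ε_Pc_P))·2K_mix·e^{−δ₄₅|x−y|_T}·(L⁻¹)^j∕(1 − L⁻¹)`. [cite: King1986, Lemma 4.5 (4.38) p.674 (its use: the tower is Cauchy)] -/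
theorem kingFirstOrderE_limit_rate (ha : 0 < a) (hm : 0 < m2) (hL : 2 ≤ L) {P : ℕ → Matrix (Tor (fine L M)) (Tor (fine L M)) ℝ}
    {Pinf : Matrix (Tor (fine L M)) (Tor (fine L M)) ℝ} {cP εP t : ℝ} (hcP0 : 0 ≤ cP) (hεP0 : 0 ≤ εP) (htc : |t| * cP ≤ kingCbar dd a L)
    (htε : |t| * εP ≤ kingCbar dd a L) (h335 : UniformKernelDecay P (tdistT (fine L M)) cP (kapCT dd a L))
    (h336 : EffectiveOperatorSupRate P εP (((L : ℝ) ^ 2)⁻¹)) (hP : ∀ z w, Tendsto (fun k => P k z w) atTop (𝓝 (Pinf z w))) (j : ℕ)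
    (x y : Tor (fine L M)) :
    |(kingCovE a m2 L M (t • P) j * P j * kingCovE a m2 L M (t • P) j) x y - (kingCovLimE a m2 L M (t • P) * Pinf * kingCovLimE a m2 L M (t • P)) x y|
      ≤ (cP + Real.sqrt (2 * (εP * cP))) * (2 * kingKmix dd a L) * Real.exp (-(delta45 dd a L * tdistT (fine L M) x y))
          * ((L : ℝ)⁻¹) ^ j / (1 - (L : ℝ)⁻¹) := by
  have hlim := kingFirstOrderE_tendsto (dd := dd) ha hm hL hcP0 hεP0 htc htε h335 h336 hP x y
  have hstep : ∀ k, dist ((kingCovE a m2 L M (t • P) k * P k * kingCovE a m2 L M (t • P) k) x y)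
      ((kingCovE a m2 L M (t • P) (k + 1) * P (k + 1) * kingCovE a m2 L M (t • P) (k + 1)) x y)
        ≤ (cP + Real.sqrt (2 * (εP * cP))) * (2 * kingKmix dd a L) * Real.exp (-(delta45 dd a L * tdistT (fine L M) x y)) * ((L : ℝ)⁻¹) ^ k :=
    fun k => by
    rw [Real.dist_eq, abs_sub_comm, ← Matrix.sub_apply]
    refine (kingFirstOrderE_rate (dd := dd) ha hm hL hcP0 hεP0 htc htε h335 h336 k x y).trans (le_of_eq ?_)
    ring
  have h := dist_le_of_le_geometric_of_tendsto _ _ (inv_L_nonneg_lt_one hL).2 hstep hlim j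
  rwa [Real.dist_eq] at h

/-- **THE BACKGROUND-DERIVATIVE AND THE η → 0 LIMIT COMMUTE, AT RATE `L^{−j}`** (`L ≥ 2`, `a, m² > 0`): for a direction `P` (local at `κ′`, size `c_P`;
two-spacing rate `ε_P·L^{−2j}`; entrywise limit `P_∞`) and couplings in the open window `|t| < T`, `T·c_P ≤ c̄`, `T·ε_P ≤ c̄`, at every level and all sites
`|∂_tC^{(j)}_{tP}(x,y) − ∂_tC^{(∞)}_{tP}(x,y)| ≤ (c_P + √(2ε_Pc_P))·2K_mix·e^{−δ₄₅|x−y|_T}·(L⁻¹)^j∕(1 − L⁻¹)` — the derivatives of King's unit-lattice covariances in the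
background coupling converge as η → 0 to the derivative of the continuum limit, geometrically in `j`, linearly in the direction's size, with decay.
HONEST SCOPE: abstract local perturbation towers dressing King's `A = 0` tower; letters for Bałaban's `Δ^{(k)}(U) − Δ^{(k)}(1)` NOT PRINTED; count-neutral.
[cite: King1986, Lemma 4.5 (4.38) p.674, (4.39)–(4.41) p.675, §4 pp.675–676; Balaban1985BackgroundPropagators, Thm 3.4 p.400 (analytic dependence at fixed spacing: the shape)] -/
theorem deriv_kingCovE_sub_deriv_kingCovLimE_le (ha : 0 < a) (hm : 0 < m2) (hL : 2 ≤ L) {P : ℕ → Matrix (Tor (fine L M)) (Tor (fine L M)) ℝ}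
    {Pinf : Matrix (Tor (fine L M)) (Tor (fine L M)) ℝ} {cP εP T t : ℝ} (hcP0 : 0 ≤ cP) (hεP0 : 0 ≤ εP) (hT : T * cP ≤ kingCbar dd a L)
    (hT' : T * εP ≤ kingCbar dd a L) (ht : |t| < T) (h335 : UniformKernelDecay P (tdistT (fine L M)) cP (kapCT dd a L))
    (h336 : EffectiveOperatorSupRate P εP (((L : ℝ) ^ 2)⁻¹)) (hP : ∀ z w, Tendsto (fun k => P k z w) atTop (𝓝 (Pinf z w))) (j : ℕ)
    (x y : Tor (fine L M)) :
    |deriv (fun u : ℝ => kingCovE a m2 L M (u • P) j x y) t - deriv (fun u : ℝ => kingCovLimE a m2 L M (u • P) x y) t|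
      ≤ (cP + Real.sqrt (2 * (εP * cP))) * (2 * kingKmix dd a L) * Real.exp (-(delta45 dd a L * tdistT (fine L M) x y))
          * ((L : ℝ)⁻¹) ^ j / (1 - (L : ℝ)⁻¹) := by
  have htc : |t| * cP ≤ kingCbar dd a L := (mul_le_mul_of_nonneg_right ht.le hcP0).trans hT
  have htε : |t| * εP ≤ kingCbar dd a L := (mul_le_mul_of_nonneg_right ht.le hεP0).trans hT'
  rw [(hasDerivAt_kingCovE_smul (dd := dd) ha hm hL hcP0 hT ht h335 j x y).deriv,
    (hasDerivAt_kingCovLimE_smul (dd := dd) ha hm hL hcP0 hεP0 hT hT' ht h335 h336 hP x y).deriv, neg_sub_neg, abs_sub_comm]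
  exact kingFirstOrderE_limit_rate (dd := dd) ha hm hL hcP0 hεP0 htc htε h335 h336 hP j x y

/-- **THE DIRECTION'S LIMIT EXISTS** (so the hypothesis `P_k → P_∞` above is supplied by the two-spacing letter alone): `P_k(z,w) → P_∞(z,w)` with tail
`ε_P·(L⁻²)^k∕(1 − L⁻²)`, and `P_∞` is local at `κ′` with the same size `c_P` (part 5's `tower_limit`, `tower_limit_abs_le`). [cite: King1986, Lemma 4.3 (4.18) p.672 (the Cauchy mechanism)] -/
theorem direction_limit (hL : 2 ≤ L) {P : ℕ → Matrix (Tor (fine L M)) (Tor (fine L M)) ℝ} {cP εP : ℝ}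
    (h335 : UniformKernelDecay P (tdistT (fine L M)) cP (kapCT dd a L)) (h336 : EffectiveOperatorSupRate P εP (((L : ℝ) ^ 2)⁻¹)) :
    ∃ Pinf : Matrix (Tor (fine L M)) (Tor (fine L M)) ℝ, (∀ z w, Tendsto (fun k => P k z w) atTop (𝓝 (Pinf z w)) ∧
      ∀ k, |P k z w - Pinf z w| ≤ εP * (((L : ℝ) ^ 2)⁻¹) ^ k / (1 - ((L : ℝ) ^ 2)⁻¹)) ∧
      ∀ z w, |Pinf z w| ≤ cP * Real.exp (-(2 * kapCT dd a L * tdistT (fine L M) z w)) := by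
  have hLr : (1 : ℝ) < L := by exact_mod_cast hL
  have hr1 : ((L : ℝ) ^ 2)⁻¹ < 1 := inv_lt_one_of_one_lt₀ (by nlinarith)
  obtain ⟨Pinf, hP⟩ := tower_limit hr1 h336
  exact ⟨Pinf, hP, tower_limit_abs_le (fun z w => (hP z w).1) h335⟩

/-- **PACKAGED: THE η → 0 LIMIT OF KING'S DRESSED COVARIANCE IS DIFFERENTIABLE ALONG EVERY REGULAR DIRECTION AT EVERY COUPLING OF THE WINDOW, WITH THE DERIVATIVE'S RATE** (`L ≥ 2`, `a, m² > 0`): for a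
direction `P` carrying the locality letter (size `c_P` at `κ′`) and the two-spacing letter (`ε_P·L^{−2j}`), and a window `T·c_P ≤ c̄`, `T·ε_P ≤ c̄`: the direction
has an entrywise limit `P_∞`, and for every `|t| < T` and all sites, `u ↦ C^{(∞)}_{uP}(x,y)` has derivative `−(C^{(∞)}_{tP}P_∞C^{(∞)}_{tP})(x,y)` at `t`, to which
the level derivatives `∂_tC^{(j)}_{tP}(x,y)` converge at rate `(c_P + √(2ε_Pc_P))·2K_mix·e^{−δ₄₅|x−y|_T}·L^{−j}∕(1 − L⁻¹)`. [cite: King1986, Lemma 4.5 (4.38) p.674, (4.39)–(4.41) p.675, §4 pp.675–676 (A = 0 template)] -/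
theorem king_dressedLimit_hasDerivAt (ha : 0 < a) (hm : 0 < m2) (hL : 2 ≤ L) {P : ℕ → Matrix (Tor (fine L M)) (Tor (fine L M)) ℝ} {cP εP T : ℝ}
    (hcP0 : 0 ≤ cP) (hεP0 : 0 ≤ εP) (hT : T * cP ≤ kingCbar dd a L) (hT' : T * εP ≤ kingCbar dd a L)
    (h335 : UniformKernelDecay P (tdistT (fine L M)) cP (kapCT dd a L)) (h336 : EffectiveOperatorSupRate P εP (((L : ℝ) ^ 2)⁻¹)) :
    ∃ Pinf : Matrix (Tor (fine L M)) (Tor (fine L M)) ℝ, (∀ z w, Tendsto (fun k => P k z w) atTop (𝓝 (Pinf z w))) ∧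
      ∀ t : ℝ, |t| < T → ∀ x y : Tor (fine L M),
        HasDerivAt (fun u : ℝ => kingCovLimE a m2 L M (u • P) x y) (-((kingCovLimE a m2 L M (t • P) * Pinf * kingCovLimE a m2 L M (t • P)) x y)) t ∧
        ∀ j : ℕ, |deriv (fun u : ℝ => kingCovE a m2 L M (u • P) j x y) t - deriv (fun u : ℝ => kingCovLimE a m2 L M (u • P) x y) t|
          ≤ (cP + Real.sqrt (2 * (εP * cP))) * (2 * kingKmix dd a L) * Real.exp (-(delta45 dd a L * tdistT (fine L M) x y))
              * ((L : ℝ)⁻¹) ^ j / (1 - (L : ℝ)⁻¹) := by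
  obtain ⟨Pinf, hP, -⟩ := direction_limit (dd := dd) (a := a) hL h335 h336
  exact ⟨Pinf, fun z w => (hP z w).1, fun t ht x y =>
    ⟨hasDerivAt_kingCovLimE_smul (dd := dd) ha hm hL hcP0 hεP0 hT hT' ht h335 h336 (fun z w => (hP z w).1) x y, fun j =>
      deriv_kingCovE_sub_deriv_kingCovLimE_le (dd := dd) ha hm hL hcP0 hεP0 hT hT' ht h335 h336 (fun z w => (hP z w).1) j x y⟩⟩

end Rate

end Summit.QuantumFields.YangMills.BalabanUVNodes.N15.KingModel

end
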